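import Literature.Analysis.FluidPDE.ElgindiKMomentEnergy
import Literature.Analysis.FluidPDE.ElgindiRadialAveragingHardy
import Mathlib.Analysis.SpecialFunctions.Integrals.Basic
import HarnessLib

/-!
# The `L₁₂`-corrector of Theorem 2: the averaging operator `T_p` in the radial energies
([Elgindi2021] §7.5, Lemma 7.10 and the construction of `G = G⋆ + Ḡ`)

Topic `Literature/Analysis/FluidPDE`. Support file (definitions with bodies and proved theorems, no
named facts) on the proof path of the named fact
`Literature.Analysis.FluidPDE.Elgindi.ElgindiGhoulMasmoudi2021_stabilityCore`
(`ElgindiStabilityDecomposition.lean`). T. M. Elgindi, Ann. of Math. 194 (2021) =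
arXiv:1904.04795, §7.5 (p. 24): Lemma 7.10 and the corrector `G`.

`radAvg p f (R) = R^{−p}∫₀^R ρ^{p−1}f(ρ)dρ` (`T_p`). For `f` smooth and vanishing on `R < a`
(`a > 0`): `T_pf ∈ C⁴(0,∞)`, `Dz₁^j(T_pf) = T_p(Dz₁^jf)` on `(0,∞)` (`iterate_Dz₁_radAvg`), and the
weighted Hardy inequality of `ElgindiRadialAveragingHardy.lean`, summed over the five power weights
of `w² = (1+R)⁴/R⁴`, gives `A_j(T_pf) ≤ (2/(2p−1))²A_j(f)` for compactly supported `f`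
(`radialEnergy_radAvg_le`).
-/

noncomputable section

open MeasureTheory Set Real Filter Function Finset intervalIntegral
open _root_.Topology
open scoped ENNReal ContDiff

namespace Literature.Analysis.FluidPDE

namespace Elgindi

/-! ### The averaging operator -/

/-- `T_pf(R) = R^{−p}∫₀^R ρ^{p−1}f(ρ)dρ`. [cite: Elgindi2021, §7.5 Lemma 7.10 (p. 24 of arXiv:1904.04795)] -/
def radAvg (p : ℝ) (f : ℝ → ℝ) (R : ℝ) : ℝ := R ^ (-p) * ∫ ρ in (0:ℝ)..R, ρ ^ (p - 1) * f ρ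

section calc_

variable {f : ℝ → ℝ} {a : ℝ}

/-- `T_pf = 0` on `R < a` when `f = 0` there. [folklore] -/
theorem radAvg_eq_zero_of_lt (ha : 0 < a) (hfa : ∀ R < a, f R = 0) (p : ℝ) {R : ℝ} (hR : R < a) : radAvg p f R = 0 := by
  unfold radAvg; rw [radialPrim_eq_zero_of_lt ha hfa p hR, mul_zero]

/-- `Dz₁(T_pf) = T_p(Dz₁f)` on `(0,∞)` for `f ∈ C¹` vanishing on `R < a`. [folklore] -/
theorem Dz₁_radAvg_eq (ha : 0 < a) (hf : ContDiff ℝ 1 f) (hfa : ∀ R < a, f R = 0) {p : ℝ} (hp : 0 < p) {R : ℝ} (hR : 0 < R) :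
    Dz₁ (radAvg p f) R = radAvg p (Dz₁ f) R := by
  unfold radAvg
  have h1 := Dz₁_radialAvg hf.continuous ha hfa p hR
  have h2 := radialAvg_Dz₁ hf ha hfa hp hR
  rw [h2]; exact h1

/-- `Dz₁f` vanishes on `R < a` too. [folklore] -/
theorem Dz₁_eq_zero_of_lt (hfa : ∀ R < a, f R = 0) {R : ℝ} (hR : R < a) : Dz₁ f R = 0 := by
  have h0 : f =ᶠ[𝓝 R] fun _ => 0 := Filter.eventuallyEq_of_mem (Iio_mem_nhds hR) fun x hx => hfa x hx
  rw [Dz₁_apply, h0.deriv_eq, deriv_const, mul_zero]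

/-- Iterates vanish on `R < a`. [folklore] -/
theorem iterate_Dz₁_eq_zero_of_lt (hfa : ∀ R < a, f R = 0) (j : ℕ) : ∀ R < a, (Dz₁^[j] f) R = 0 := by
  induction j generalizing f with
  | zero => exact hfa
  | succ j ih => intro R hR; rw [Function.iterate_succ_apply]; exact ih (fun R hR => Dz₁_eq_zero_of_lt hfa hR) R hR

/-- `Dz₁` keeps `C^∞`. [folklore] -/
theorem contDiff_Dz₁_infty {g : ℝ → ℝ} (hg : ContDiff ℝ ∞ g) : ContDiff ℝ ∞ (Dz₁ g) := by
  have e : Dz₁ g = fun z => z * deriv g z := rfl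
  rw [e]; exact contDiff_id.mul (hg.iterate_deriv 1 |> fun h => by simpa using h)

/-- Iterates keep `C^∞`. [folklore] -/
theorem contDiff_iterate_Dz₁_infty {g : ℝ → ℝ} (hg : ContDiff ℝ ∞ g) (j : ℕ) : ContDiff ℝ ∞ (Dz₁^[j] g) := by
  induction j generalizing g with
  | zero => exact hg
  | succ j ih => rw [Function.iterate_succ]; exact ih (contDiff_Dz₁_infty hg)

/-- **`Dz₁^j(T_pf) = T_p(Dz₁^jf)` on `(0,∞)`** for `f ∈ C^∞` vanishing on `R < a`, `p > 0`. [folklore] -/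
theorem iterate_Dz₁_radAvg (ha : 0 < a) (hf : ContDiff ℝ ∞ f) (hfa : ∀ R < a, f R = 0) {p : ℝ} (hp : 0 < p) (j : ℕ) :
    EqOn (Dz₁^[j] (radAvg p f)) (radAvg p (Dz₁^[j] f)) (Ioi 0) := by
  induction j generalizing f with
  | zero => intro R _; rfl
  | succ j ih =>
    intro R hR
    rw [Function.iterate_succ_apply, Function.iterate_succ_apply]
    have e1 : EqOn (Dz₁ (radAvg p f)) (radAvg p (Dz₁ f)) (Ioi 0) := fun R hR => Dz₁_radAvg_eq ha (contDiff_infty.1 hf 1) hfa hp hR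
    rw [iterate_Dz₁_congr_Ioi e1 j hR]
    exact ih (contDiff_Dz₁_infty hf) (fun R hR => Dz₁_eq_zero_of_lt hfa hR) hR

/-- **`T_pf ∈ Cⁿ(0,∞)`** for continuous `f` vanishing on `R < a` which is `Cⁿ`. [folklore] -/
theorem contDiffOn_radAvg (ha : 0 < a) (hf : ContDiff ℝ ∞ f) (hfa : ∀ R < a, f R = 0) (p : ℝ) (n : ℕ) : ContDiffOn ℝ n (radAvg p f) (Ioi 0) := by
  have hpow : ContDiffOn ℝ n (fun R : ℝ => R ^ (-p)) (Ioi 0) := fun R hR =>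
    (Real.contDiffAt_rpow_const_of_ne (p := -p) (ne_of_gt hR)).contDiffWithinAt.of_le (by exact_mod_cast le_top)
  -- the primitive is `C^{n}`: its derivative `R^{p-1}f` is `C^∞` on `(0,∞)`
  have hM : ContDiffOn ℝ n (fun R => ∫ ρ in (0:ℝ)..R, ρ ^ (p - 1) * f ρ) (Ioi 0) := by
    have hd : ∀ R, HasDerivAt (fun R => ∫ ρ in (0:ℝ)..R, ρ ^ (p - 1) * f ρ) (R ^ (p - 1) * f R) R :=
      hasDerivAt_radialPrim hf.continuous ha hfa p
    have hderiv : ContDiffOn ℝ ∞ (fun R : ℝ => R ^ (p - 1) * f R) (Ioi 0) := fun R hR =>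
      ((Real.contDiffAt_rpow_const_of_ne (p := p - 1) (ne_of_gt hR)).mul hf.contDiffAt).contDiffWithinAt
    induction n with
    | zero => exact contDiffOn_zero.2 (continuous_iff_continuousAt.2 fun R => (hd R).continuousAt).continuousOn
    | succ n ih =>
      refine (contDiffOn_succ_iff_deriv_of_isOpen (n := (n : WithTop ℕ∞)) isOpen_Ioi).2 ⟨fun R _ => (hd R).differentiableAt.differentiableWithinAt,
        fun h => absurd h (by exact_mod_cast WithTop.natCast_ne_top n), ?_⟩
      have e : EqOn (deriv fun R => ∫ ρ in (0:ℝ)..R, ρ ^ (p - 1) * f ρ) (fun R : ℝ => R ^ (p - 1) * f R) (Ioi 0) := fun R _ => (hd R).deriv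
      exact (hderiv.of_le (by exact_mod_cast le_top)).congr e
  have e : radAvg p f = fun R => R ^ (-p) * ∫ ρ in (0:ℝ)..R, ρ ^ (p - 1) * f ρ := rfl
  rw [e]
  exact hpow.mul hM

end calc_

/-! ### The weighted Hardy inequality in the radial energies -/

/-- `w² = (1+R)⁴/R⁴ = R^{−4} + 4R^{−3} + 6R^{−2} + 4R^{−1} + 1` on `R > 0` (rpow form). [folklore] -/
theorem radialWeight_sq_expand {R : ℝ} (hR : 0 < R) :
    radialWeight R ^ 2 = R ^ (-4:ℝ) + 4 * R ^ (-3:ℝ) + 6 * R ^ (-2:ℝ) + 4 * R ^ (-1:ℝ) + R ^ (0:ℝ) := by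
  unfold radialWeight
  rw [show (-4:ℝ) = -((4:ℕ) : ℝ) by norm_num, show (-3:ℝ) = -((3:ℕ) : ℝ) by norm_num, show (-2:ℝ) = -((2:ℕ) : ℝ) by norm_num,
    show (-1:ℝ) = -((1:ℕ) : ℝ) by norm_num, Real.rpow_neg hR.le, Real.rpow_neg hR.le, Real.rpow_neg hR.le, Real.rpow_neg hR.le,
    Real.rpow_natCast, Real.rpow_natCast, Real.rpow_natCast, Real.rpow_natCast, Real.rpow_zero]
  field_simp
  ring

/-- Integrability of `R^c(T_pf)²` on `(0,∞)` for `f` continuous supported in `[a,b]`, `2p − c > 1`. [folklore] -/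
theorem integrableOn_rpow_mul_sq_radAvg {f : ℝ → ℝ} (hf : Continuous f) {a b : ℝ} (ha : 0 < a) (hab : a ≤ b)
    (hfa : ∀ R < a, f R = 0) (hfb : ∀ R, b < R → f R = 0) {p c : ℝ} (hp : (c + 1) / 2 < p) :
    IntegrableOn (fun R => R ^ c * radAvg p f R ^ 2) (Ioi 0) := by
  set M : ℝ → ℝ := fun R => ∫ ρ in (0:ℝ)..R, ρ ^ (p - 1) * f ρ with hM
  have hMc : Continuous M := continuous_radialPrim hf ha hfa p
  have hM0 : ∀ R < a, M R = 0 := fun R hR => radialPrim_eq_zero_of_lt ha hfa p hR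
  have hMb : ∀ R, b ≤ R → M R = M b := fun R hR => radialPrim_eq_of_le hf ha hfa hfb p le_rfl hR
  have eX : ∀ R ∈ Ioi (0:ℝ), R ^ c * radAvg p f R ^ 2 = R ^ (c - 2 * p) * M R ^ 2 := by
    intro R hR
    have hR : (0:ℝ) < R := hR
    show R ^ c * (R ^ (-p) * M R) ^ 2 = _
    rw [mul_pow, ← Real.rpow_natCast (R ^ (-p)), ← Real.rpow_mul hR.le, ← mul_assoc, ← Real.rpow_add hR]
    congr 1; congr 1; push_cast; ring
  have iX : IntegrableOn (fun R => R ^ (c - 2 * p) * M R ^ 2) (Ioi 0) := by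
    have h1 : IntegrableOn (fun R => R ^ (c - 2 * p) * M R ^ 2) (Ioc 0 b) := by
      have hc : Continuous fun R => R ^ (c - 2 * p) * M R ^ 2 :=
        continuous_mul_of_eq_zero_lt (u := fun R : ℝ => R ^ (c - 2 * p))
          (fun R hR => (Real.continuousAt_rpow_const R _ (Or.inl hR)).continuousWithinAt) (hMc.pow 2) ha
          fun R hR => by simp [hM0 R hR]
      exact (hc.continuousOn.integrableOn_Icc (a := 0) (b := b)).mono_set Ioc_subset_Icc_self
    have h2 : IntegrableOn (fun R => R ^ (c - 2 * p) * M R ^ 2) (Ioi b) := by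
      have hb0 : 0 < b := ha.trans_le hab
      have hi : IntegrableOn (fun R : ℝ => R ^ (c - 2 * p) * M b ^ 2) (Ioi b) :=
        (integrableOn_Ioi_rpow_of_lt (show c - 2 * p < -1 by linarith) hb0).mul_const (M b ^ 2)
      refine hi.congr_fun (fun R hR => ?_) measurableSet_Ioi
      show R ^ (c - 2 * p) * M b ^ 2 = R ^ (c - 2 * p) * M R ^ 2
      rw [hMb R (le_of_lt hR)]
    have hu : Ioi (0:ℝ) = Ioc 0 b ∪ Ioi b := (Ioc_union_Ioi_eq_Ioi (ha.trans_le hab).le).symm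
    rw [hu]; exact h1.union h2
  exact iX.congr_fun (fun R hR => (eX R hR).symm) measurableSet_Ioi

/-- **The weighted Hardy inequality for `T_p` in the radial energy `A₀`**:
`∫_{R>0} w²(T_pf)² ≤ (2/(2p−1))²∫_{R>0} w²f²` for continuous `f` supported in `[a,b] ⊂ (0,∞)`, `p > 1/2`.
[cite: Elgindi2021, §7.5 Lemma 7.10 (p. 24 of arXiv:1904.04795)] -/
theorem radialEnergy_zero_radAvg_le {f : ℝ → ℝ} (hf : Continuous f) {a b : ℝ} (ha : 0 < a) (hab : a ≤ b)
    (hfa : ∀ R < a, f R = 0) (hfb : ∀ R, b < R → f R = 0) {p : ℝ} (hp : 1 / 2 < p) :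
    radialEnergy 0 (radAvg p f) ≤ ENNReal.ofReal ((2 / (2 * p - 1)) ^ 2) * radialEnergy 0 f := by
  -- the five power weights
  have hcs : ∀ c : ℝ, c ≤ 0 → (c + 1) / 2 < p := fun c hc => by linarith
  have hconst : ∀ c : ℝ, -4 ≤ c → c ≤ 0 → (2 / (2 * p - c - 1)) ^ 2 ≤ (2 / (2 * p - 1)) ^ 2 := by
    intro c hc4 hc0
    have h1 : 0 < 2 * p - 1 := by linarith
    have h2 : 2 * p - 1 ≤ 2 * p - c - 1 := by linarith
    have h3 : 2 / (2 * p - c - 1) ≤ 2 / (2 * p - 1) := div_le_div_of_nonneg_left (by norm_num) h1 h2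
    have h4 : 0 ≤ 2 / (2 * p - c - 1) := div_nonneg (by norm_num) (by linarith)
    exact pow_le_pow_left₀ h4 h3 2
  -- each real Hardy inequality, and integrability
  have H : ∀ c : ℝ, -4 ≤ c → c ≤ 0 → (∫ R in Ioi 0, R ^ c * radAvg p f R ^ 2) ≤ (2 / (2 * p - 1)) ^ 2 * ∫ R in Ioi 0, R ^ c * f R ^ 2 := by
    intro c hc4 hc0
    have h := integral_rpow_mul_sq_radialAvg_le hf ha hab hfa hfb (hcs c hc0)
    have hF0 : 0 ≤ ∫ R in Ioi 0, R ^ c * f R ^ 2 := setIntegral_nonneg measurableSet_Ioi fun R hR => by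
      have : (0:ℝ) < R := hR; positivity
    exact h.trans (mul_le_mul_of_nonneg_right (hconst c hc4 hc0) hF0)
  have hfs : HasCompactSupport f := HasCompactSupport.of_support_subset_isCompact (isCompact_Icc (a := a) (b := b)) fun R hR => by
    by_contra h; simp only [Set.mem_Icc, not_and_or, not_le] at h
    exact hR (by rcases h with h | h; exact hfa R h; exact hfb R h)
  have hfs2 : HasCompactSupport fun R => f R ^ 2 := by
    have : (fun R => f R ^ 2) = fun R => f R * f R := by funext R; ring
    rw [this]; exact hfs.mul_left
  have iF : ∀ c : ℝ, IntegrableOn (fun R => R ^ c * f R ^ 2) (Ioi 0) := by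
    intro c
    have hc : Continuous fun R => R ^ c * f R ^ 2 :=
      continuous_mul_of_eq_zero_lt (u := fun R : ℝ => R ^ c)
        (fun R hR => (Real.continuousAt_rpow_const R _ (Or.inl hR)).continuousWithinAt) (hf.pow 2) ha fun R hR => by simp [hfa R hR]
    exact (hc.integrable_of_hasCompactSupport hfs2.mul_left).integrableOn
  have iT : ∀ c : ℝ, -4 ≤ c → c ≤ 0 → IntegrableOn (fun R => R ^ c * radAvg p f R ^ 2) (Ioi 0) := fun c _ hc0 =>
    integrableOn_rpow_mul_sq_radAvg hf ha hab hfa hfb (hcs c hc0)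
  -- expand the weight
  set T : ℝ → ℝ := radAvg p f with hT
  have eL : ∀ R ∈ Ioi (0:ℝ), radialWeight R ^ 2 * (Dz₁^[0] T) R ^ 2 =
      R ^ (-4:ℝ) * T R ^ 2 + 4 * (R ^ (-3:ℝ) * T R ^ 2) + 6 * (R ^ (-2:ℝ) * T R ^ 2) + 4 * (R ^ (-1:ℝ) * T R ^ 2) + R ^ (0:ℝ) * T R ^ 2 := by
    intro R hR; simp only [Function.iterate_zero, id_eq]; rw [radialWeight_sq_expand hR]; ring
  have eR : ∀ R ∈ Ioi (0:ℝ), radialWeight R ^ 2 * (Dz₁^[0] f) R ^ 2 =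
      R ^ (-4:ℝ) * f R ^ 2 + 4 * (R ^ (-3:ℝ) * f R ^ 2) + 6 * (R ^ (-2:ℝ) * f R ^ 2) + 4 * (R ^ (-1:ℝ) * f R ^ 2) + R ^ (0:ℝ) * f R ^ 2 := by
    intro R hR; simp only [Function.iterate_zero, id_eq]; rw [radialWeight_sq_expand hR]; ring
  have iL : IntegrableOn (fun R => R ^ (-4:ℝ) * T R ^ 2 + 4 * (R ^ (-3:ℝ) * T R ^ 2) + 6 * (R ^ (-2:ℝ) * T R ^ 2) + 4 * (R ^ (-1:ℝ) * T R ^ 2) + R ^ (0:ℝ) * T R ^ 2) (Ioi 0) :=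
    ((((iT (-4) (by norm_num) (by norm_num)).add ((iT (-3) (by norm_num) (by norm_num)).const_mul 4)).add ((iT (-2) (by norm_num) (by norm_num)).const_mul 6)).add
      ((iT (-1) (by norm_num) (by norm_num)).const_mul 4)).add (iT 0 (by norm_num) le_rfl)
  have iR : IntegrableOn (fun R => R ^ (-4:ℝ) * f R ^ 2 + 4 * (R ^ (-3:ℝ) * f R ^ 2) + 6 * (R ^ (-2:ℝ) * f R ^ 2) + 4 * (R ^ (-1:ℝ) * f R ^ 2) + R ^ (0:ℝ) * f R ^ 2) (Ioi 0) :=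
    ((((iF (-4)).add ((iF (-3)).const_mul 4)).add ((iF (-2)).const_mul 6)).add ((iF (-1)).const_mul 4)).add (iF 0)
  have iL' : IntegrableOn (fun R => radialWeight R ^ 2 * (Dz₁^[0] T) R ^ 2) (Ioi 0) := iL.congr_fun (fun R hR => (eL R hR).symm) measurableSet_Ioi
  have iR' : IntegrableOn (fun R => radialWeight R ^ 2 * (Dz₁^[0] f) R ^ 2) (Ioi 0) := iR.congr_fun (fun R hR => (eR R hR).symm) measurableSet_Ioi
  unfold radialEnergy
  rw [← ofReal_integral_eq_lintegral_ofReal iL' (ae_of_all _ fun R => by positivity),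
    ← ofReal_integral_eq_lintegral_ofReal iR' (ae_of_all _ fun R => by positivity), ← ENNReal.ofReal_mul (sq_nonneg _)]
  refine ENNReal.ofReal_le_ofReal ?_
  rw [setIntegral_congr_fun measurableSet_Ioi eL, setIntegral_congr_fun measurableSet_Ioi eR]
  have sL : ∫ R in Ioi 0, (R ^ (-4:ℝ) * T R ^ 2 + 4 * (R ^ (-3:ℝ) * T R ^ 2) + 6 * (R ^ (-2:ℝ) * T R ^ 2) + 4 * (R ^ (-1:ℝ) * T R ^ 2) + R ^ (0:ℝ) * T R ^ 2) =
      (∫ R in Ioi 0, R ^ (-4:ℝ) * T R ^ 2) + 4 * (∫ R in Ioi 0, R ^ (-3:ℝ) * T R ^ 2) + 6 * (∫ R in Ioi 0, R ^ (-2:ℝ) * T R ^ 2) +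
        4 * (∫ R in Ioi 0, R ^ (-1:ℝ) * T R ^ 2) + ∫ R in Ioi 0, R ^ (0:ℝ) * T R ^ 2 := by
    have i4 : Integrable (fun R => R ^ (-4:ℝ) * T R ^ 2) (volume.restrict (Ioi 0)) := iT (-4) (by norm_num) (by norm_num)
    have i3 : Integrable (fun R => 4 * (R ^ (-3:ℝ) * T R ^ 2)) (volume.restrict (Ioi 0)) := (iT (-3) (by norm_num) (by norm_num)).const_mul 4
    have i2 : Integrable (fun R => 6 * (R ^ (-2:ℝ) * T R ^ 2)) (volume.restrict (Ioi 0)) := (iT (-2) (by norm_num) (by norm_num)).const_mul 6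
    have i1 : Integrable (fun R => 4 * (R ^ (-1:ℝ) * T R ^ 2)) (volume.restrict (Ioi 0)) := (iT (-1) (by norm_num) (by norm_num)).const_mul 4
    have i0 : Integrable (fun R => R ^ (0:ℝ) * T R ^ 2) (volume.restrict (Ioi 0)) := iT 0 (by norm_num) le_rfl
    have i43 : Integrable (fun R => R ^ (-4:ℝ) * T R ^ 2 + 4 * (R ^ (-3:ℝ) * T R ^ 2)) (volume.restrict (Ioi 0)) := i4.add i3
    have i432 : Integrable (fun R => R ^ (-4:ℝ) * T R ^ 2 + 4 * (R ^ (-3:ℝ) * T R ^ 2) + 6 * (R ^ (-2:ℝ) * T R ^ 2)) (volume.restrict (Ioi 0)) := i43.add i2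
    have i4321 : Integrable (fun R => R ^ (-4:ℝ) * T R ^ 2 + 4 * (R ^ (-3:ℝ) * T R ^ 2) + 6 * (R ^ (-2:ℝ) * T R ^ 2) + 4 * (R ^ (-1:ℝ) * T R ^ 2)) (volume.restrict (Ioi 0)) := i432.add i1
    rw [integral_add i4321 i0, integral_add i432 i1, integral_add i43 i2, integral_add i4 i3,
      MeasureTheory.integral_const_mul, MeasureTheory.integral_const_mul, MeasureTheory.integral_const_mul]
  have sR : ∫ R in Ioi 0, (R ^ (-4:ℝ) * f R ^ 2 + 4 * (R ^ (-3:ℝ) * f R ^ 2) + 6 * (R ^ (-2:ℝ) * f R ^ 2) + 4 * (R ^ (-1:ℝ) * f R ^ 2) + R ^ (0:ℝ) * f R ^ 2) =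
      (∫ R in Ioi 0, R ^ (-4:ℝ) * f R ^ 2) + 4 * (∫ R in Ioi 0, R ^ (-3:ℝ) * f R ^ 2) + 6 * (∫ R in Ioi 0, R ^ (-2:ℝ) * f R ^ 2) +
        4 * (∫ R in Ioi 0, R ^ (-1:ℝ) * f R ^ 2) + ∫ R in Ioi 0, R ^ (0:ℝ) * f R ^ 2 := by
    have i4 : Integrable (fun R => R ^ (-4:ℝ) * f R ^ 2) (volume.restrict (Ioi 0)) := iF (-4)
    have i3 : Integrable (fun R => 4 * (R ^ (-3:ℝ) * f R ^ 2)) (volume.restrict (Ioi 0)) := (iF (-3)).const_mul 4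
    have i2 : Integrable (fun R => 6 * (R ^ (-2:ℝ) * f R ^ 2)) (volume.restrict (Ioi 0)) := (iF (-2)).const_mul 6
    have i1 : Integrable (fun R => 4 * (R ^ (-1:ℝ) * f R ^ 2)) (volume.restrict (Ioi 0)) := (iF (-1)).const_mul 4
    have i0 : Integrable (fun R => R ^ (0:ℝ) * f R ^ 2) (volume.restrict (Ioi 0)) := iF 0
    have i43 : Integrable (fun R => R ^ (-4:ℝ) * f R ^ 2 + 4 * (R ^ (-3:ℝ) * f R ^ 2)) (volume.restrict (Ioi 0)) := i4.add i3
    have i432 : Integrable (fun R => R ^ (-4:ℝ) * f R ^ 2 + 4 * (R ^ (-3:ℝ) * f R ^ 2) + 6 * (R ^ (-2:ℝ) * f R ^ 2)) (volume.restrict (Ioi 0)) := i43.add i2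
    have i4321 : Integrable (fun R => R ^ (-4:ℝ) * f R ^ 2 + 4 * (R ^ (-3:ℝ) * f R ^ 2) + 6 * (R ^ (-2:ℝ) * f R ^ 2) + 4 * (R ^ (-1:ℝ) * f R ^ 2)) (volume.restrict (Ioi 0)) := i432.add i1
    rw [integral_add i4321 i0, integral_add i432 i1, integral_add i43 i2, integral_add i4 i3,
      MeasureTheory.integral_const_mul, MeasureTheory.integral_const_mul, MeasureTheory.integral_const_mul]
  rw [sL, sR]
  have h4 := H (-4) (by norm_num) (by norm_num); have h3 := H (-3) (by norm_num) (by norm_num)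
  have h2 := H (-2) (by norm_num) (by norm_num); have h1 := H (-1) (by norm_num) (by norm_num); have h0 := H 0 (by norm_num) le_rfl
  nlinarith [h4, h3, h2, h1, h0, sq_nonneg (2 / (2 * p - 1))]

/-- **Higher radial energies**: `A_j(T_pf) ≤ (2/(2p−1))²A_j(f)` for `f ∈ C^∞` supported in `[a,b] ⊂ (0,∞)`, `p > 1/2`. [folklore] -/
theorem radialEnergy_radAvg_le {f : ℝ → ℝ} (hf : ContDiff ℝ ∞ f) {a b : ℝ} (ha : 0 < a) (hab : a ≤ b)
    (hfa : ∀ R < a, f R = 0) (hfb : ∀ R, b < R → f R = 0) {p : ℝ} (hp : 1 / 2 < p) (j : ℕ) :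
    radialEnergy j (radAvg p f) ≤ ENNReal.ofReal ((2 / (2 * p - 1)) ^ 2) * radialEnergy j f := by
  have hp0 : 0 < p := by linarith
  -- `A_j(T_pf) = A_0(Dz₁^j T_pf) = A_0(T_p(Dz₁^jf))`
  have e1 : radialEnergy j (radAvg p f) = radialEnergy 0 (radAvg p (Dz₁^[j] f)) := by
    unfold radialEnergy
    refine setLIntegral_congr_fun measurableSet_Ioi fun R hR => ?_
    simp only [Function.iterate_zero, id_eq]
    rw [iterate_Dz₁_radAvg ha hf hfa hp0 j hR]
  have e2 : radialEnergy j f = radialEnergy 0 (Dz₁^[j] f) := by unfold radialEnergy; simp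
  rw [e1, e2]
  -- iterates vanish beyond `b` as well (locally zero there)
  have key : ∀ (g : ℝ → ℝ), (∀ R, b < R → g R = 0) → ∀ R, b < R → Dz₁ g R = 0 := by
    intro g hg R hR
    have h0 : g =ᶠ[𝓝 R] fun _ => 0 := Filter.eventuallyEq_of_mem (Ioi_mem_nhds hR) fun x hx => hg x hx
    rw [Dz₁_apply, h0.deriv_eq, deriv_const, mul_zero]
  have hfbj : ∀ (j : ℕ) (g : ℝ → ℝ), (∀ R, b < R → g R = 0) → ∀ R, b < R → (Dz₁^[j] g) R = 0 := by
    intro j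
    induction j with
    | zero => intro g hg; exact hg
    | succ j ih => intro g hg R hR; rw [Function.iterate_succ_apply]; exact ih (Dz₁ g) (key g hg) R hR
  exact radialEnergy_zero_radAvg_le (contDiff_iterate_Dz₁_infty hf j).continuous ha hab (iterate_Dz₁_eq_zero_of_lt hfa j) (hfbj j f hfb) hp


/-! ### The corrector `G = G⋆ + Ḡ` of Theorem 2 -/

section corrector

variable {α : ℝ} {F : ℝ → ℝ → ℝ}

/-- `Ḡ = −(4α)⁻¹T_{5/α}(kMoment F)`. [cite: Elgindi2021, §7.5 (p. 24 of arXiv:1904.04795): G = G⋆ + Ḡ] -/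
def Gbar (α : ℝ) (F : ℝ → ℝ → ℝ) (R : ℝ) : ℝ := -(1 / (4 * α)) * radAvg (5 / α) (kMoment F) R

/-- `G⋆ = −(4α)⁻¹L₁₂(F)`. [cite: Elgindi2021, §7.5 (p. 24 of arXiv:1904.04795): G⋆ = −(1/(4α))L₁₂(F)] -/
def Gstar (α : ℝ) (F : ℝ → ℝ → ℝ) (R : ℝ) : ℝ := -(1 / (4 * α)) * L12 F R

/-- The corrector `G = G⋆ + Ḡ`. [cite: Elgindi2021, §7.5 (p. 24 of arXiv:1904.04795)] -/
def Gcor (α : ℝ) (F : ℝ → ℝ → ℝ) (R : ℝ) : ℝ := Gstar α F R + Gbar α F R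

/-- **Nice data**: smooth, compactly supported inside the open strip. [folklore] -/
structure NiceDatum (F : ℝ → ℝ → ℝ) : Prop where
  smooth : ∀ n : ℕ, ContDiff ℝ n (uncurry F)
  supp : HasCompactSupport (uncurry F)
  sub : tsupport (uncurry F) ⊆ strip

namespace NiceDatum

variable (hF : NiceDatum F)
include hF

/-- Radial bounds of the datum and vanishing of `kMoment F` outside them. [folklore] -/
theorem kMoment_support : ∃ a b : ℝ, 0 < a ∧ a ≤ b ∧ (∀ R < a, kMoment F R = 0) ∧ ∀ R, b < R → kMoment F R = 0 := by
  obtain ⟨a, b, ha, hab, h⟩ := exists_radial_bounds' hF.supp hF.sub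
  exact ⟨a, b, ha, hab, fun R hR => kMoment_eq_zero_of_not_mem h (Or.inl hR), fun R hR => kMoment_eq_zero_of_not_mem h (Or.inr hR)⟩

/-- `kMoment F ∈ C^∞`. [folklore] -/
theorem contDiff_kM : ContDiff ℝ ∞ (kMoment F) := contDiff_infty.2 fun n => contDiff_kMoment (hF.smooth n) hF.supp

/-- `L₁₂(F) ∈ C^∞`. [folklore] -/
theorem contDiff_L12F : ContDiff ℝ ∞ (L12 F) := contDiff_infty.2 fun n => contDiff_L12 (hF.smooth n) hF.supp hF.sub

/-- **`Dz₁G⋆ = kMoment F/(4α)`.** [folklore] -/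
theorem Dz₁_Gstar (hα : 0 < α) (R : ℝ) : Dz₁ (Gstar α F) R = kMoment F R / (4 * α) := by
  have e : Gstar α F = fun R => -(1 / (4 * α)) * L12 F R := rfl
  rw [e, show Dz₁ (fun R => -(1 / (4 * α)) * L12 F R) R = -(1 / (4 * α)) * Dz₁ (L12 F) R from congrFun (iterate_Dz₁_const_mul' _ _ 1) R,
    Dz₁_L12 (hF.smooth 0).continuous hF.supp hF.sub R]
  field_simp

/-- **`Dz₁Ḡ = −kMoment F/(4α) − (5/α)Ḡ` on `R > 0`.** [folklore] -/
theorem Dz₁_Gbar (hα : 0 < α) {R : ℝ} (hR : 0 < R) : Dz₁ (Gbar α F) R = -(kMoment F R) / (4 * α) - (5 / α) * Gbar α F R := by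
  obtain ⟨a, b, ha, -, hka, -⟩ := hF.kMoment_support
  have e : Gbar α F = fun R => -(1 / (4 * α)) * radAvg (5 / α) (kMoment F) R := rfl
  rw [e, show Dz₁ (fun R => -(1 / (4 * α)) * radAvg (5 / α) (kMoment F) R) R = -(1 / (4 * α)) * Dz₁ (radAvg (5 / α) (kMoment F)) R from
    congrFun (iterate_Dz₁_const_mul' _ _ 1) R]
  have h := Dz₁_radialAvg hF.contDiff_kM.continuous ha hka (5 / α) hR
  unfold radAvg
  rw [h]
  simp only
  field_simp
  ring

/-- `Ḡ ∈ Cⁿ(0,∞)`. [folklore] -/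
theorem contDiffOn_Gbar (n : ℕ) : ContDiffOn ℝ n (Gbar α F) (Ioi 0) := by
  obtain ⟨a, b, ha, -, hka, -⟩ := hF.kMoment_support
  exact contDiffOn_const.mul (contDiffOn_radAvg ha hF.contDiff_kM hka (5 / α) n)

/-- `G ∈ Cⁿ(0,∞)`. [folklore] -/
theorem contDiffOn_Gcor (n : ℕ) : ContDiffOn ℝ n (Gcor α F) (Ioi 0) := by
  have h1 : ContDiffOn ℝ n (Gstar α F) (Ioi 0) := contDiffOn_const.mul (contDiff_infty.1 hF.contDiff_L12F n).contDiffOn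
  exact (h1.add (hF.contDiffOn_Gbar n)).congr fun R _ => rfl

/-- **`Dz₁G = −(5/α)Ḡ` on `R > 0`.** [folklore] -/
theorem Dz₁_Gcor (hα : 0 < α) {R : ℝ} (hR : 0 < R) : Dz₁ (Gcor α F) R = -(5 / α) * Gbar α F R := by
  have e : Gcor α F = fun R => Gstar α F R + Gbar α F R := rfl
  have hdS : DifferentiableAt ℝ (Gstar α F) R := ((hF.contDiff_L12F.differentiable (by simp)) R).const_mul _
  have hdB : DifferentiableAt ℝ (Gbar α F) R :=
    ((hF.contDiffOn_Gbar 1).differentiableOn (by simp)).differentiableAt (Ioi_mem_nhds hR)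
  have hsum : HasDerivAt (fun R => Gstar α F R + Gbar α F R) (deriv (Gstar α F) R + deriv (Gbar α F) R) R := hdS.hasDerivAt.add hdB.hasDerivAt
  rw [e, Dz₁_apply, hsum.deriv, mul_add, ← Dz₁_apply, ← Dz₁_apply, hF.Dz₁_Gstar hα, hF.Dz₁_Gbar hα hR]
  ring

/-- **`Dz₁²G = (5/(4α²))kMoment F + (25/α²)Ḡ` on `R > 0`.** [folklore] -/
theorem Dz₁_Dz₁_Gcor (hα : 0 < α) {R : ℝ} (hR : 0 < R) : Dz₁ (Dz₁ (Gcor α F)) R = 5 / (4 * α ^ 2) * kMoment F R + 25 / α ^ 2 * Gbar α F R := by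
  have e : EqOn (Dz₁ (Gcor α F)) (fun R => -(5 / α) * Gbar α F R) (Ioi 0) := fun R hR => hF.Dz₁_Gcor hα hR
  have h2 := iterate_Dz₁_congr_Ioi e 1 hR
  simp only [Function.iterate_one] at h2
  rw [h2, show Dz₁ (fun R => -(5 / α) * Gbar α F R) R = -(5 / α) * Dz₁ (Gbar α F) R from congrFun (iterate_Dz₁_const_mul' _ _ 1) R,
    hF.Dz₁_Gbar hα hR]
  field_simp
  ring

/-- **The corrector ODE**: `α²Dz₁²G + 5αDz₁G = (5/4)kMoment F` on `R > 0`. [cite: Elgindi2021, §7.5 (p. 24 of arXiv:1904.04795): "α²R²∂_{RR}G + α(5+α)R∂_RG = −(15/4)F⋆" (with the sign conventions of (PolarBSL))] -/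
theorem corrector_ode (hα : 0 < α) {R : ℝ} (hR : 0 < R) : α ^ 2 * Dz₁ (Dz₁ (Gcor α F)) R + 5 * α * Dz₁ (Gcor α F) R = 5 / 4 * kMoment F R := by
  rw [hF.Dz₁_Dz₁_Gcor hα hR, hF.Dz₁_Gcor hα hR]
  field_simp
  ring

end NiceDatum

end corrector

/-! ### `L` on separable products `g(R) sin 2θ` -/

/-- `∂_z(g ⊗ s) = g′ ⊗ s` (no hypotheses). [folklore] -/
theorem dz_tensor (g s : ℝ → ℝ) : dz (tensor g s) = tensor (deriv g) s := by
  funext z θ; show deriv (fun z' => g z' * s θ) z = deriv g z * s θ; exact deriv_mul_const_field _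

/-- `∂_θ(g ⊗ s) = g ⊗ s′` (no hypotheses). [folklore] -/
theorem dθ_tensor (g s : ℝ → ℝ) : dθ (tensor g s) = tensor g (deriv s) := by
  funext z θ; show deriv (fun θ' => g z * s θ') θ = g z * deriv s θ; exact deriv_const_mul_field _

/-- `(sin 2θ)′ = 2cos 2θ` and `(sin 2θ)″ = −4 sin 2θ`. [folklore] -/
theorem deriv_sin2 : deriv sin2 = fun θ => 2 * Real.cos (2 * θ) := by
  funext θ
  have h1 : HasDerivAt (fun x : ℝ => 2 * x) 2 θ := by simpa using (hasDerivAt_id θ).const_mul 2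
  have h : HasDerivAt sin2 (Real.cos (2 * θ) * 2) θ := h1.sin
  rw [h.deriv]; ring

/-- `(sin 2θ)″ = −4 sin 2θ`. [folklore] -/
theorem deriv_deriv_sin2 : deriv (deriv sin2) = fun θ => -4 * Real.sin (2 * θ) := by
  rw [deriv_sin2]; funext θ
  have h1 : HasDerivAt (fun x : ℝ => 2 * x) 2 θ := by simpa using (hasDerivAt_id θ).const_mul 2
  have h : HasDerivAt (fun θ => 2 * Real.cos (2 * θ)) (2 * (-Real.sin (2 * θ) * 2)) θ := h1.cos.const_mul 2
  rw [h.deriv]; ring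

/-- On `(0,π/2)`: `(tan θ·sin 2θ)′ = 2 sin 2θ` (`tan θ sin 2θ = 2 sin²θ` near such `θ`). [folklore] -/
theorem deriv_tan_mul_sin2 {θ : ℝ} (hθ : θ ∈ Ioo (0:ℝ) (π / 2)) : deriv (fun θ' => Real.tan θ' * sin2 θ') θ = 2 * Real.sin (2 * θ) := by
  have hev : (fun θ' => Real.tan θ' * sin2 θ') =ᶠ[𝓝 θ] fun θ' => 2 * Real.sin θ' ^ 2 := by
    filter_upwards [isOpen_Ioo.mem_nhds hθ] with t ht
    have hc : Real.cos t ≠ 0 := (Real.cos_pos_of_mem_Ioo ⟨by linarith [ht.1, Real.pi_pos], ht.2⟩).ne'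
    simp only [sin2]; rw [Real.tan_eq_sin_div_cos, Real.sin_two_mul]; field_simp
  rw [hev.deriv_eq]
  have h : HasDerivAt (fun θ' => 2 * Real.sin θ' ^ 2) (2 * (((2:ℕ) : ℝ) * Real.sin θ ^ (2 - 1) * Real.cos θ)) θ := ((Real.hasDerivAt_sin θ).pow 2).const_mul 2
  rw [h.deriv, Real.sin_two_mul]; push_cast; ring

/-- **`L(g ⊗ sin 2θ) = −(α²Dz₁²g + 5αDz₁g) ⊗ sin 2θ` on the strip** for `g ∈ C²(0,∞)` (the angular part
of `L` kills `sin 2θ`). [cite: Elgindi2021, §7.5 (p. 24 of arXiv:1904.04795): "L(G(R) sin(2θ)) = (α²R²∂_{RR}G + α(5+α)R∂_RG) sin(2θ)" (with the sign conventions of (PolarBSL))] -/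
theorem ellipticOp_tensor_sin2 (α : ℝ) {g : ℝ → ℝ} (hg : ContDiffOn ℝ 2 g (Ioi 0)) {p : ℝ × ℝ} (hp : p ∈ strip) :
    ellipticOp α (tensor g sin2) p.1 p.2 = -(α ^ 2 * Dz₁ (Dz₁ g) p.1 + 5 * α * Dz₁ g p.1) * Real.sin (2 * p.2) := by
  have hd1 : DifferentiableAt ℝ g p.1 := (hg.differentiableOn (by norm_num)).differentiableAt (Ioi_mem_nhds hp.1)
  have hg' : ContDiffOn ℝ 1 (deriv g) (Ioi 0) := (hg.deriv_of_isOpen isOpen_Ioi (by norm_num))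
  have hd2 : DifferentiableAt ℝ (deriv g) p.1 := (hg'.differentiableOn (by norm_num)).differentiableAt (Ioi_mem_nhds hp.1)
  -- `Dz₁(Dz₁ g) = z(g' + z g'')` at `p.1`
  have eDz : Dz₁ (Dz₁ g) p.1 = p.1 * (deriv g p.1 + p.1 * deriv (deriv g) p.1) := by
    rw [Dz₁_apply]
    have e : Dz₁ g = fun z => z * deriv g z := rfl
    have h : HasDerivAt (fun z => z * deriv g z) (1 * deriv g p.1 + p.1 * deriv (deriv g) p.1) p.1 := (hasDerivAt_id p.1).mul hd2.hasDerivAt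
    rw [e, h.deriv]; ring
  unfold ellipticOp
  rw [dz_tensor, dz_tensor, dθ_tensor, dθ_tensor, deriv_deriv_sin2]
  have e5 : dθ (fun z' θ' => Real.tan θ' * tensor g sin2 z' θ') p.1 p.2 = g p.1 * (2 * Real.sin (2 * p.2)) := by
    show deriv (fun θ' => Real.tan θ' * (g p.1 * sin2 θ')) p.2 = _
    rw [show (fun θ' => Real.tan θ' * (g p.1 * sin2 θ')) = fun θ' => g p.1 * (Real.tan θ' * sin2 θ') by funext θ'; ring,
      deriv_const_mul_field, deriv_tan_mul_sin2 hp.2]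
  rw [e5]
  simp only [tensor_apply, sin2, Dz₁_apply] at eDz ⊢
  rw [eDz]
  ring

/-! ### The angular integral `∫ sin 2θ·K = 4/5` and the modified datum -/

/-- **`∫₀^{π/2} sin(2θ)K(θ) dθ = 4/5`** (`K = 3 sin θcos²θ`). [folklore] -/
theorem integral_sin2_mul_kernelK : ∫ θ in Ioo 0 (π / 2), Real.sin (2 * θ) * kernelK θ = 4 / 5 := by
  have e : ∀ θ, Real.sin (2 * θ) * kernelK θ = 6 * (Real.sin θ ^ 2 * Real.cos θ ^ (2 * 1 + 1)) := fun θ => by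
    unfold kernelK; rw [Real.sin_two_mul]; ring
  simp_rw [e]
  rw [← integral_Ioc_eq_integral_Ioo, ← intervalIntegral.integral_of_le (by positivity : (0:ℝ) ≤ π / 2), intervalIntegral.integral_const_mul,
    integral_sin_pow_mul_cos_pow_odd]
  simp only [Real.sin_zero, Real.sin_pi_div_two, pow_one]
  have e2 : ∀ u : ℝ, u ^ 2 * (1 - u ^ 2) = u ^ 2 - u ^ 4 := fun u => by ring
  simp_rw [e2]
  rw [intervalIntegral.integral_sub ((by fun_prop : Continuous fun u : ℝ => u ^ 2).intervalIntegrable _ _) ((by fun_prop : Continuous fun u : ℝ => u ^ 4).intervalIntegrable _ _),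
    integral_pow, integral_pow]
  norm_num

end Elgindi

end Literature.Analysis.FluidPDE
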